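import Summits.BirchSwinnertonDyer.BirchSwinnertonDyer.Theses.SignedLowerHalves
import Summits.BirchSwinnertonDyer.BirchSwinnertonDyer.Theorems.SignedBaseChangeTwistPairGreenbergProductDivisibilitySplitAcanchorGlue
import HarnessLib

/-!
# «defanchor» — typability sketch + the PROVED anchor composition for the designed line of crux idea
# `definite-line-unit-lift` (REVISION g3, G4) on `KobayashiLowerHalfSemistable` (stmt-BirchSwinnertonDyer-19000)

Ideator bsd-idea-13 g3 (planner-bsd-idea-13-g3-0, 2026-08-28). NOTHING about any curve is asserted and NO line
is registered (LINE-FIRST / W-71: `Lines/birth.lean` 7996fe65 stays the skeleton of record; registration of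
«defanchor» is a pen/director decision, ASK on the director bus 2026-08-28). This file shows:

* S2 `DefinitePackage`, S3 `ES2Definite`, S4 `DefiniteLineEisenstein` of card G4 ELABORATE today, typed VERBATIM
  over the binder block of `BurungaleSkinnerTianWan2024.props118_27_519_exists_signedTwoVariablePackage_
  supersingular_PRE` (which carries NO Heegner clause) with the definite-CR clauses of S1 inserted after
  `IsCoprime N D_K` (X6 at `5 ≤ p`; one prime `q₀ ∥ N` inert in `K`, every other `ℓ ∣ N` split; (CR)
  `p ∤ v_{q₀}(Δ_W)` or `q₀² ≢ 1 (mod p)`), and with the conjunct `UnrSeries₂.minus Lsig ≠ 0` that the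
  guardrail (`DefiniteLineUnitLiftGuardrail`, G1/G3) shows is needed for the ∀-form to be faithful;
  S3 is the text of `SignedBaseChange.TwoVariableEulerSystemDivisibility` (stmt-20728)'s conclusion with
  `G ≠ 0` added (for a definite `K`, `minus G = 0`, so non-vanishing of `G` is a genuine input here);
* the ANCHOR COMPOSITION `defAnchor_of : DefinitePackage → ES2Definite → DefiniteLineEisenstein → DefAnchor`
  is PROVED (binder threading + `charIdealIsPrincipal₂` + the guardrail's `associated_of_signedLineAnchor`):
  the two-variable signed association `ξ_∘ ~ 𝓛^∘` for SOME package pair, for every definite-CR datum — the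
  input of the designed cyclotomic-sandwich stub S5 (K2R⁗ template), which is NOT typed here.
No `sorry`; no new definitions of mathematical objects (four `Prop` abbreviations of existing vocabulary).
-/

-- D-0017: single-problem summit, the namespace repeats the problem name by design.
set_option linter.dupNamespace false
set_option autoImplicit false

noncomputable section

open scoped Classical

open NumberField IsDedekindDomain Field CongruenceSubgroup
open Literature.NumberTheory.GaloisRepresentations
open Literature.NumberTheory.EllipticCurves Literature.NumberTheory.EllipticCurves.BurungaleSkinnerTianWan2024
open Literature.NumberTheory.EllipticCurves.ModularForms

namespace Summit.BirchSwinnertonDyer.BirchSwinnertonDyer.Cruxes.KobayashiLowerHalfSemistable.Defanchor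

open Summit.BirchSwinnertonDyer.BirchSwinnertonDyer.Theorems.SignedBaseChangeK1Acanchor

/-! ### §0 The signed-currency anchor lift (VERBATIM copy of `DefiniteLineUnitLiftGuardrail.associated_of_signedLineAnchor`,
crux workfile bfdfddda0d0c — inlined so that this sketch does not depend on the build state of a `Cruxes/` module) -/

section SignedAnchor

variable {A : Type*} [CommRing A] [IsDomain A]

/-- **Signed-currency anchor lift.** In `A⟦T₁⟧` over a domain `A` (think `A = 𝒪⟦T₂⟧`, line `T₁ = 0` =
`constantCoeff`): if `I` is principal, `(ξ·G) = I·(L)` (P1), `(G) ⊆ I` (two-variable Euler system),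
`G ≠ 0`, `L(0) ≠ 0` and `L(0) ∣ ξ(0)` (Eisenstein divisibility ON THE LINE for the signed pair), then
`ξ ~ L`. Proof: `I = (c)`, `G = c·h`, `ξ·c·h ~ c·L` gives `L = ξ·h·u`; on the line `L₀ = ξ₀h₀u₀` and
`ξ₀ = L₀m` force `m·h₀·u₀ = 1`, so `h` is a unit (`PowerSeries.isUnit_iff_constantCoeff`). -/
theorem associated_of_signedLineAnchor {I : Ideal (PowerSeries A)} (hI : I.IsPrincipal)
    {ξ L G : PowerSeries A}
    (hP1 : Ideal.span {ξ * G} = I * Ideal.span {L})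
    (hES : Ideal.span {G} ≤ I) (hG : G ≠ 0)
    (hne : PowerSeries.constantCoeff L ≠ 0)
    (hanch : PowerSeries.constantCoeff L ∣ PowerSeries.constantCoeff ξ) :
    Associated ξ L := by
  obtain ⟨⟨c, hc⟩⟩ := hI
  have hc' : I = Ideal.span {c} := hc
  subst hc'
  -- `G = c * h`
  obtain ⟨h, rfl⟩ : c ∣ G :=
    Ideal.mem_span_singleton.mp (hES (Ideal.mem_span_singleton_self G))
  have hc0 : c ≠ 0 := left_ne_zero_of_mul hG
  -- (P1) as an association `ξ * (c * h) ~ c * L`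
  have hP1' : Ideal.span {ξ * (c * h)} = Ideal.span {c * L} := by
    rw [hP1, Ideal.span_singleton_mul_span_singleton]
  obtain ⟨u, hu⟩ := (Ideal.span_singleton_eq_span_singleton.mp hP1')
  -- cancel `c`: `L = ξ * h * u`
  have hL : L = ξ * (h * u) := by
    apply mul_left_cancel₀ hc0
    calc c * L = ξ * (c * h) * u := hu.symm
      _ = c * (ξ * (h * u)) := by ring
  -- on the line: `h(0)` is a unit
  have h0 : PowerSeries.constantCoeff L =
      PowerSeries.constantCoeff ξ * (PowerSeries.constantCoeff h * PowerSeries.constantCoeff (u : PowerSeries A)) := by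
    conv_lhs => rw [hL]
    simp [map_mul]
  obtain ⟨m, hm⟩ := hanch
  have h1 : PowerSeries.constantCoeff h *
      (PowerSeries.constantCoeff (u : PowerSeries A) * m) = 1 := by
    apply mul_left_cancel₀ hne
    calc PowerSeries.constantCoeff L *
          (PowerSeries.constantCoeff h * (PowerSeries.constantCoeff (u : PowerSeries A) * m))
          = (PowerSeries.constantCoeff L * m) *
            (PowerSeries.constantCoeff h * PowerSeries.constantCoeff (u : PowerSeries A)) := by ring
      _ = PowerSeries.constantCoeff ξ *
            (PowerSeries.constantCoeff h * PowerSeries.constantCoeff (u : PowerSeries A)) := by rw [← hm]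
      _ = PowerSeries.constantCoeff L := h0.symm
      _ = PowerSeries.constantCoeff L * 1 := (mul_one _).symm
  have hhu : IsUnit h :=
    PowerSeries.isUnit_iff_constantCoeff.mpr (IsUnit.of_mul_eq_one _ h1)
  refine ⟨hhu.unit * u, ?_⟩
  rw [hL, Units.val_mul, IsUnit.unit_spec]

end SignedAnchor

/-- **S2 `stub_definitePackage` (designed, PRE-grade + Cornut–Vatsal non-vanishing):** for every definite-CR datum
the BSTW signed two-variable package exists WITH `𝓛^∘` non-zero on the anticyclotomic line `T₁ = 0`.
Text = the PRE package binder verbatim + definite clauses + the conjunct `minus Lsig ≠ 0`. Nothing asserted. -/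
def DefinitePackage : Prop :=
  ∀ {p : ℕ} [Fact p.Prime] (ι : PadicAlgCl p ≃+* ℂ) (W : WeierstrassCurve ℚ) [W.IsElliptic]
    [W.IsGloballyMinimal] (K : Type) [Field K] [NumberField K] (v vbar : HeightOneSpectrum (𝓞 K))
    (κ₁ κ₂ : ZpExtension K p) (γ₁ γ₂ : absoluteGaloisGroup K)
    [Fact (ZpExtension.IsTopGeneratorPair κ₁ κ₂ γ₁ γ₂)] {N : ℕ} [NeZero N] (f : CuspForm (Gamma0 N) 2)
    [NeZero (NumberField.discr K).natAbs],
    IsNewformOf W f → (N : ℤ) = W.conductorNorm ℤ → p ≠ 2 → ¬ (p : ℤ) ∣ W.conductorNorm ℤ →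
    W.frobeniusTrace p = 0 →
    IsImaginaryQuadratic K → ((Ideal.span {(p : ℤ)}).primesOver (𝓞 K)).ncard = 2 →
    ((p : ℕ) : 𝓞 K) ∈ v.asIdeal → ((p : ℕ) : 𝓞 K) ∈ vbar.asIdeal → vbar ≠ v →
    (∀ (w : InfinitePlace K) (k : 𝓞 K), k ∈ v.asIdeal ↔ ‖ι.symm (w.embedding (k : K))‖ < 1) →
    IsCoprime (N : ℤ) (NumberField.discr K) →
    -- ⟨definite-CR clauses (card G4 S1): X6 at 5 ≤ p; ONE prime q₀ ∥ N inert in K, every other ℓ ∣ N split;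
    --  (CR) ρ̄ ramified at q₀ (p ∤ v_{q₀}(Δ_W), Tate) or q₀² ≢ 1 (mod p)⟩
    5 ≤ p → Rank1Residual.ClassX6 W p →
    ∀ q₀ : ℕ, q₀.Prime → q₀ ∣ N → ¬ (q₀ ^ 2 ∣ N) →
      ((Ideal.span {(q₀ : ℤ)}).primesOver (𝓞 K)).ncard = 1 →
      (∀ ℓ : ℕ, ℓ.Prime → ℓ ∣ N → ℓ ≠ q₀ → ((Ideal.span {(ℓ : ℤ)}).primesOver (𝓞 K)).ncard = 2) →
      (¬ ((p : ℤ) ∣ padicValRat q₀ W.Δ) ∨ ¬ (q₀ ^ 2 ≡ 1 [MOD p])) →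
    (∀ ρ : ModPGaloisRep K (ZMod p) 2, (W.baseChange K).IsTorsionGaloisRep p ρ →
      FramedRep.IsAbsolutelyIrreducible ρ) →
    κ₁.IsCyclotomic → κ₂.IsAnticyclotomic →
    ∀ (Ω δ : ℂ) (Ωp : (unrIntegers p)ˣ) (LK G : PowerSeries (PowerSeries (PadicComplexInt p))),
      Ω ≠ 0 → (δ ^ 2 = (NumberField.discr K : ℂ) ∨ δ ^ 2 = -(NumberField.discr K : ℂ)) →
      IsKatzMeasure₂ ι v vbar ∅ κ₁ κ₂ γ₁⁻¹ γ₂⁻¹ 1 Ω δ ((Ωp : unrIntegers p) : PadicComplex p) LK →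
      IsGreenbergLFunctionAnyRoot₂ ι v vbar κ₁ κ₂ γ₁⁻¹ γ₂⁻¹ f (NumberField.discr K).natAbs
        (NumberField.classNumber K) LK G →
    ∀ J : ℤ_[p] →+* PadicComplexInt p,
      (∀ x : ℤ_[p], ((J x : PadicComplexInt p) : PadicComplex p) = ((x : ℚ_[p]) : PadicComplex p)) →
    ∀ ε : ℤˣ,
    ∃ xi Lsig : PowerSeries (PowerSeries (PadicComplexInt p)),
      UnrSeries₂.minus Lsig ≠ 0 ∧
      (Ideal.span {xi * G} =
          (WeierstrassCurve.XGr₂.charIdeal (W.baseChange K) p κ₁ κ₂ vbar γ₁ γ₂).map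
              (IwasawaAlgebra₂.toUnr₂ p J) * Ideal.span {Lsig} ∧
      ∀ (κ : ZpExtension ℚ p) (γ : absoluteGaloisGroup ℚ), κ.IsCyclotomic → κ.IsTopGenerator γ →
        IsCyclotomicVariable p γ →
        (∃ ζ : ℤ_[p]ˣ, IsOfFinOrder ζ ∧
          GaloisRep.cyclotomicCharacter ℚ p γ * ζ = GaloisRep.cyclotomicCharacter K p γ₁) →
        ∀ (W₂ : WeierstrassCurve ℚ) [W₂.IsElliptic] [W₂.IsGloballyMinimal]
          (C₂ : WeierstrassCurve.VariableChange ℚ),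
          C₂ • W₂ = W.quadraticTwist (NumberField.discr K : ℚ) →
          (∀ (D₁ : Kobayashi2003.SignedSelmerDualData W κ γ ε)
              (D₂ : Kobayashi2003.SignedSelmerDualData W₂ κ γ ε) (g₁ g₂ : IwasawaAlgebra p),
              D₁.charIdeal = Ideal.span {g₁} → D₂.charIdeal = Ideal.span {g₂} →
              UnrSeries₂.plus xi ∣ PowerSeries.map J (g₁ * g₂)) ∧
          (∀ {N₂ : ℕ} [NeZero N₂] (f₂ : CuspForm (Gamma0 N₂) 2), IsNewformOf W₂ f₂ →
            ∀ (L₁ L₂ : IwasawaAlgebra p), Kobayashi2003.IsSignedPAdicLFunction f p ε L₁ →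
              Kobayashi2003.IsSignedPAdicLFunction f₂ p ε L₂ →
              ∃ u : PowerSeries (PadicComplexInt p), IsUnit u ∧
                UnrSeries₂.plus Lsig = u * PowerSeries.map J (L₁ * L₂)))

/-- **S3 `stub_ES2definite` (designed; twin of stmt-20728 for a definite-CR `K`, with `G ≠ 0`):** the integral
two-variable Euler-system inclusion `(G) ⊆ ch(X_Gr₂(E/K_∞))^ur` and `G ≠ 0`. Nothing asserted. -/
def ES2Definite : Prop :=
  ∀ {p : ℕ} [Fact p.Prime] (ι : PadicAlgCl p ≃+* ℂ) (W : WeierstrassCurve ℚ) [W.IsElliptic]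
    [W.IsGloballyMinimal] (K : Type) [Field K] [NumberField K] (v vbar : HeightOneSpectrum (𝓞 K))
    (κ₁ κ₂ : ZpExtension K p) (γ₁ γ₂ : absoluteGaloisGroup K)
    [Fact (ZpExtension.IsTopGeneratorPair κ₁ κ₂ γ₁ γ₂)] {N : ℕ} [NeZero N] (f : CuspForm (Gamma0 N) 2)
    [NeZero (NumberField.discr K).natAbs],
    IsNewformOf W f → (N : ℤ) = W.conductorNorm ℤ → p ≠ 2 → ¬ (p : ℤ) ∣ W.conductorNorm ℤ →
    W.frobeniusTrace p = 0 →
    IsImaginaryQuadratic K → ((Ideal.span {(p : ℤ)}).primesOver (𝓞 K)).ncard = 2 →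
    ((p : ℕ) : 𝓞 K) ∈ v.asIdeal → ((p : ℕ) : 𝓞 K) ∈ vbar.asIdeal → vbar ≠ v →
    (∀ (w : InfinitePlace K) (k : 𝓞 K), k ∈ v.asIdeal ↔ ‖ι.symm (w.embedding (k : K))‖ < 1) →
    IsCoprime (N : ℤ) (NumberField.discr K) →
    -- ⟨definite-CR clauses (card G4 S1): X6 at 5 ≤ p; ONE prime q₀ ∥ N inert in K, every other ℓ ∣ N split;
    --  (CR) ρ̄ ramified at q₀ (p ∤ v_{q₀}(Δ_W), Tate) or q₀² ≢ 1 (mod p)⟩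
    5 ≤ p → Rank1Residual.ClassX6 W p →
    ∀ q₀ : ℕ, q₀.Prime → q₀ ∣ N → ¬ (q₀ ^ 2 ∣ N) →
      ((Ideal.span {(q₀ : ℤ)}).primesOver (𝓞 K)).ncard = 1 →
      (∀ ℓ : ℕ, ℓ.Prime → ℓ ∣ N → ℓ ≠ q₀ → ((Ideal.span {(ℓ : ℤ)}).primesOver (𝓞 K)).ncard = 2) →
      (¬ ((p : ℤ) ∣ padicValRat q₀ W.Δ) ∨ ¬ (q₀ ^ 2 ≡ 1 [MOD p])) →
    (∀ ρ : ModPGaloisRep K (ZMod p) 2, (W.baseChange K).IsTorsionGaloisRep p ρ →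
      FramedRep.IsAbsolutelyIrreducible ρ) →
    κ₁.IsCyclotomic → κ₂.IsAnticyclotomic →
    ∀ (Ω δ : ℂ) (Ωp : (unrIntegers p)ˣ) (LK G : PowerSeries (PowerSeries (PadicComplexInt p))),
      Ω ≠ 0 → (δ ^ 2 = (NumberField.discr K : ℂ) ∨ δ ^ 2 = -(NumberField.discr K : ℂ)) →
      IsKatzMeasure₂ ι v vbar ∅ κ₁ κ₂ γ₁⁻¹ γ₂⁻¹ 1 Ω δ ((Ωp : unrIntegers p) : PadicComplex p) LK →
      IsGreenbergLFunctionAnyRoot₂ ι v vbar κ₁ κ₂ γ₁⁻¹ γ₂⁻¹ f (NumberField.discr K).natAbs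
        (NumberField.classNumber K) LK G →
    ∀ J : ℤ_[p] →+* PadicComplexInt p,
      (∀ x : ℤ_[p], ((J x : PadicComplexInt p) : PadicComplex p) = ((x : ℚ_[p]) : PadicComplex p)) →
      G ≠ 0 ∧
      Ideal.span {G} ≤
        (WeierstrassCurve.XGr₂.charIdeal (W.baseChange K) p κ₁ κ₂ vbar γ₁ γ₂).map (IwasawaAlgebra₂.toUnr₂ p J)

/-- **S4 `stub_definiteLineEisenstein` (designed; the card's WALL — one-variable definite signed anticyclotomic
Eisenstein inclusion, ∀-form over ALL package solutions with `minus Lsig ≠ 0`):** `𝓛^∘⁻ ∣ ξ_∘⁻`. Nothing asserted. -/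
def DefiniteLineEisenstein : Prop :=
  ∀ {p : ℕ} [Fact p.Prime] (ι : PadicAlgCl p ≃+* ℂ) (W : WeierstrassCurve ℚ) [W.IsElliptic]
    [W.IsGloballyMinimal] (K : Type) [Field K] [NumberField K] (v vbar : HeightOneSpectrum (𝓞 K))
    (κ₁ κ₂ : ZpExtension K p) (γ₁ γ₂ : absoluteGaloisGroup K)
    [Fact (ZpExtension.IsTopGeneratorPair κ₁ κ₂ γ₁ γ₂)] {N : ℕ} [NeZero N] (f : CuspForm (Gamma0 N) 2)
    [NeZero (NumberField.discr K).natAbs],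
    IsNewformOf W f → (N : ℤ) = W.conductorNorm ℤ → p ≠ 2 → ¬ (p : ℤ) ∣ W.conductorNorm ℤ →
    W.frobeniusTrace p = 0 →
    IsImaginaryQuadratic K → ((Ideal.span {(p : ℤ)}).primesOver (𝓞 K)).ncard = 2 →
    ((p : ℕ) : 𝓞 K) ∈ v.asIdeal → ((p : ℕ) : 𝓞 K) ∈ vbar.asIdeal → vbar ≠ v →
    (∀ (w : InfinitePlace K) (k : 𝓞 K), k ∈ v.asIdeal ↔ ‖ι.symm (w.embedding (k : K))‖ < 1) →
    IsCoprime (N : ℤ) (NumberField.discr K) →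
    -- ⟨definite-CR clauses (card G4 S1): X6 at 5 ≤ p; ONE prime q₀ ∥ N inert in K, every other ℓ ∣ N split;
    --  (CR) ρ̄ ramified at q₀ (p ∤ v_{q₀}(Δ_W), Tate) or q₀² ≢ 1 (mod p)⟩
    5 ≤ p → Rank1Residual.ClassX6 W p →
    ∀ q₀ : ℕ, q₀.Prime → q₀ ∣ N → ¬ (q₀ ^ 2 ∣ N) →
      ((Ideal.span {(q₀ : ℤ)}).primesOver (𝓞 K)).ncard = 1 →
      (∀ ℓ : ℕ, ℓ.Prime → ℓ ∣ N → ℓ ≠ q₀ → ((Ideal.span {(ℓ : ℤ)}).primesOver (𝓞 K)).ncard = 2) →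
      (¬ ((p : ℤ) ∣ padicValRat q₀ W.Δ) ∨ ¬ (q₀ ^ 2 ≡ 1 [MOD p])) →
    (∀ ρ : ModPGaloisRep K (ZMod p) 2, (W.baseChange K).IsTorsionGaloisRep p ρ →
      FramedRep.IsAbsolutelyIrreducible ρ) →
    κ₁.IsCyclotomic → κ₂.IsAnticyclotomic →
    ∀ (Ω δ : ℂ) (Ωp : (unrIntegers p)ˣ) (LK G : PowerSeries (PowerSeries (PadicComplexInt p))),
      Ω ≠ 0 → (δ ^ 2 = (NumberField.discr K : ℂ) ∨ δ ^ 2 = -(NumberField.discr K : ℂ)) →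
      IsKatzMeasure₂ ι v vbar ∅ κ₁ κ₂ γ₁⁻¹ γ₂⁻¹ 1 Ω δ ((Ωp : unrIntegers p) : PadicComplex p) LK →
      IsGreenbergLFunctionAnyRoot₂ ι v vbar κ₁ κ₂ γ₁⁻¹ γ₂⁻¹ f (NumberField.discr K).natAbs
        (NumberField.classNumber K) LK G →
    ∀ J : ℤ_[p] →+* PadicComplexInt p,
      (∀ x : ℤ_[p], ((J x : PadicComplexInt p) : PadicComplex p) = ((x : ℚ_[p]) : PadicComplex p)) →
    ∀ ε : ℤˣ,
    ∀ xi Lsig : PowerSeries (PowerSeries (PadicComplexInt p)),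
      UnrSeries₂.minus Lsig ≠ 0 →
      (Ideal.span {xi * G} =
          (WeierstrassCurve.XGr₂.charIdeal (W.baseChange K) p κ₁ κ₂ vbar γ₁ γ₂).map
              (IwasawaAlgebra₂.toUnr₂ p J) * Ideal.span {Lsig} ∧
      ∀ (κ : ZpExtension ℚ p) (γ : absoluteGaloisGroup ℚ), κ.IsCyclotomic → κ.IsTopGenerator γ →
        IsCyclotomicVariable p γ →
        (∃ ζ : ℤ_[p]ˣ, IsOfFinOrder ζ ∧
          GaloisRep.cyclotomicCharacter ℚ p γ * ζ = GaloisRep.cyclotomicCharacter K p γ₁) →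
        ∀ (W₂ : WeierstrassCurve ℚ) [W₂.IsElliptic] [W₂.IsGloballyMinimal]
          (C₂ : WeierstrassCurve.VariableChange ℚ),
          C₂ • W₂ = W.quadraticTwist (NumberField.discr K : ℚ) →
          (∀ (D₁ : Kobayashi2003.SignedSelmerDualData W κ γ ε)
              (D₂ : Kobayashi2003.SignedSelmerDualData W₂ κ γ ε) (g₁ g₂ : IwasawaAlgebra p),
              D₁.charIdeal = Ideal.span {g₁} → D₂.charIdeal = Ideal.span {g₂} →
              UnrSeries₂.plus xi ∣ PowerSeries.map J (g₁ * g₂)) ∧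
          (∀ {N₂ : ℕ} [NeZero N₂] (f₂ : CuspForm (Gamma0 N₂) 2), IsNewformOf W₂ f₂ →
            ∀ (L₁ L₂ : IwasawaAlgebra p), Kobayashi2003.IsSignedPAdicLFunction f p ε L₁ →
              Kobayashi2003.IsSignedPAdicLFunction f₂ p ε L₂ →
              ∃ u : PowerSeries (PadicComplexInt p), IsUnit u ∧
                UnrSeries₂.plus Lsig = u * PowerSeries.map J (L₁ * L₂))) →
      UnrSeries₂.minus Lsig ∣ UnrSeries₂.minus xi

/-- **The definite anchor (conclusion of the composition):** for every definite-CR datum and sign, SOME package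
pair is ASSOCIATED two-variably, `ξ_∘ ~ 𝓛^∘` in `𝒪_{ℂ_p}⟦T₁⟧⟦T₂⟧` (input of the designed sandwich stub S5). -/
def DefAnchor : Prop :=
  ∀ {p : ℕ} [Fact p.Prime] (ι : PadicAlgCl p ≃+* ℂ) (W : WeierstrassCurve ℚ) [W.IsElliptic]
    [W.IsGloballyMinimal] (K : Type) [Field K] [NumberField K] (v vbar : HeightOneSpectrum (𝓞 K))
    (κ₁ κ₂ : ZpExtension K p) (γ₁ γ₂ : absoluteGaloisGroup K)
    [Fact (ZpExtension.IsTopGeneratorPair κ₁ κ₂ γ₁ γ₂)] {N : ℕ} [NeZero N] (f : CuspForm (Gamma0 N) 2)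
    [NeZero (NumberField.discr K).natAbs],
    IsNewformOf W f → (N : ℤ) = W.conductorNorm ℤ → p ≠ 2 → ¬ (p : ℤ) ∣ W.conductorNorm ℤ →
    W.frobeniusTrace p = 0 →
    IsImaginaryQuadratic K → ((Ideal.span {(p : ℤ)}).primesOver (𝓞 K)).ncard = 2 →
    ((p : ℕ) : 𝓞 K) ∈ v.asIdeal → ((p : ℕ) : 𝓞 K) ∈ vbar.asIdeal → vbar ≠ v →
    (∀ (w : InfinitePlace K) (k : 𝓞 K), k ∈ v.asIdeal ↔ ‖ι.symm (w.embedding (k : K))‖ < 1) →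
    IsCoprime (N : ℤ) (NumberField.discr K) →
    -- ⟨definite-CR clauses (card G4 S1): X6 at 5 ≤ p; ONE prime q₀ ∥ N inert in K, every other ℓ ∣ N split;
    --  (CR) ρ̄ ramified at q₀ (p ∤ v_{q₀}(Δ_W), Tate) or q₀² ≢ 1 (mod p)⟩
    5 ≤ p → Rank1Residual.ClassX6 W p →
    ∀ q₀ : ℕ, q₀.Prime → q₀ ∣ N → ¬ (q₀ ^ 2 ∣ N) →
      ((Ideal.span {(q₀ : ℤ)}).primesOver (𝓞 K)).ncard = 1 →
      (∀ ℓ : ℕ, ℓ.Prime → ℓ ∣ N → ℓ ≠ q₀ → ((Ideal.span {(ℓ : ℤ)}).primesOver (𝓞 K)).ncard = 2) →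
      (¬ ((p : ℤ) ∣ padicValRat q₀ W.Δ) ∨ ¬ (q₀ ^ 2 ≡ 1 [MOD p])) →
    (∀ ρ : ModPGaloisRep K (ZMod p) 2, (W.baseChange K).IsTorsionGaloisRep p ρ →
      FramedRep.IsAbsolutelyIrreducible ρ) →
    κ₁.IsCyclotomic → κ₂.IsAnticyclotomic →
    ∀ (Ω δ : ℂ) (Ωp : (unrIntegers p)ˣ) (LK G : PowerSeries (PowerSeries (PadicComplexInt p))),
      Ω ≠ 0 → (δ ^ 2 = (NumberField.discr K : ℂ) ∨ δ ^ 2 = -(NumberField.discr K : ℂ)) →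
      IsKatzMeasure₂ ι v vbar ∅ κ₁ κ₂ γ₁⁻¹ γ₂⁻¹ 1 Ω δ ((Ωp : unrIntegers p) : PadicComplex p) LK →
      IsGreenbergLFunctionAnyRoot₂ ι v vbar κ₁ κ₂ γ₁⁻¹ γ₂⁻¹ f (NumberField.discr K).natAbs
        (NumberField.classNumber K) LK G →
    ∀ J : ℤ_[p] →+* PadicComplexInt p,
      (∀ x : ℤ_[p], ((J x : PadicComplexInt p) : PadicComplex p) = ((x : ℚ_[p]) : PadicComplex p)) →
    ∀ ε : ℤˣ,
    ∃ xi Lsig : PowerSeries (PowerSeries (PadicComplexInt p)),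
      Associated xi Lsig ∧
      (Ideal.span {xi * G} =
          (WeierstrassCurve.XGr₂.charIdeal (W.baseChange K) p κ₁ κ₂ vbar γ₁ γ₂).map
              (IwasawaAlgebra₂.toUnr₂ p J) * Ideal.span {Lsig} ∧
      ∀ (κ : ZpExtension ℚ p) (γ : absoluteGaloisGroup ℚ), κ.IsCyclotomic → κ.IsTopGenerator γ →
        IsCyclotomicVariable p γ →
        (∃ ζ : ℤ_[p]ˣ, IsOfFinOrder ζ ∧
          GaloisRep.cyclotomicCharacter ℚ p γ * ζ = GaloisRep.cyclotomicCharacter K p γ₁) →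
        ∀ (W₂ : WeierstrassCurve ℚ) [W₂.IsElliptic] [W₂.IsGloballyMinimal]
          (C₂ : WeierstrassCurve.VariableChange ℚ),
          C₂ • W₂ = W.quadraticTwist (NumberField.discr K : ℚ) →
          (∀ (D₁ : Kobayashi2003.SignedSelmerDualData W κ γ ε)
              (D₂ : Kobayashi2003.SignedSelmerDualData W₂ κ γ ε) (g₁ g₂ : IwasawaAlgebra p),
              D₁.charIdeal = Ideal.span {g₁} → D₂.charIdeal = Ideal.span {g₂} →
              UnrSeries₂.plus xi ∣ PowerSeries.map J (g₁ * g₂)) ∧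
          (∀ {N₂ : ℕ} [NeZero N₂] (f₂ : CuspForm (Gamma0 N₂) 2), IsNewformOf W₂ f₂ →
            ∀ (L₁ L₂ : IwasawaAlgebra p), Kobayashi2003.IsSignedPAdicLFunction f p ε L₁ →
              Kobayashi2003.IsSignedPAdicLFunction f₂ p ε L₂ →
              ∃ u : PowerSeries (PadicComplexInt p), IsUnit u ∧
                UnrSeries₂.plus Lsig = u * PowerSeries.map J (L₁ * L₂)))

/-- **Anchor composition, PROVED:** S2 ∧ S3 ∧ S4 ⟹ the definite anchor, by `charIdealIsPrincipal₂` (two-variable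
characteristic ideals are principal) and the guardrail's `associated_of_signedLineAnchor` (which never restricts
`G` or the generator of the characteristic ideal to the line, so it survives `minus G = 0`). -/
theorem defAnchor_of (h2 : DefinitePackage) (h3 : ES2Definite) (h4 : DefiniteLineEisenstein) : DefAnchor := by
  intro p _ ι W _ _ K _ _ v vbar κ₁ κ₂ γ₁ γ₂ _ N _ f _ hf hN hp2 hpN ha0 hIQ hsp hv hvbar hvv hι hcop h5 hX6 q₀ hq₀
    hqN hq2 hin hspl hCR hirr hκ₁ hκ₂ Ω δ Ωp LK G hΩ hδ hLK hGr J hJ ε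
  obtain ⟨xi, Lsig, hne, hpkg⟩ := h2 ι W K v vbar κ₁ κ₂ γ₁ γ₂ f hf hN hp2 hpN ha0 hIQ hsp hv hvbar hvv hι hcop
    h5 hX6 q₀ hq₀ hqN hq2 hin hspl hCR hirr hκ₁ hκ₂ Ω δ Ωp LK G hΩ hδ hLK hGr J hJ ε
  obtain ⟨hG0, hES⟩ := h3 ι W K v vbar κ₁ κ₂ γ₁ γ₂ f hf hN hp2 hpN ha0 hIQ hsp hv hvbar hvv hι hcop
    h5 hX6 q₀ hq₀ hqN hq2 hin hspl hCR hirr hκ₁ hκ₂ Ω δ Ωp LK G hΩ hδ hLK hGr J hJ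
  have hdiv := h4 ι W K v vbar κ₁ κ₂ γ₁ γ₂ f hf hN hp2 hpN ha0 hIQ hsp hv hvbar hvv hι hcop
    h5 hX6 q₀ hq₀ hqN hq2 hin hspl hCR hirr hκ₁ hκ₂ Ω δ Ωp LK G hΩ hδ hLK hGr J hJ ε xi Lsig hne hpkg
  refine ⟨xi, Lsig, ?_, hpkg⟩
  have hP : (WeierstrassCurve.XGr₂.charIdeal (W.baseChange K) p κ₁ κ₂ vbar γ₁ γ₂).IsPrincipal :=
    charIdealIsPrincipal₂ p _
  have hI : ((WeierstrassCurve.XGr₂.charIdeal (W.baseChange K) p κ₁ κ₂ vbar γ₁ γ₂).map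
      (IwasawaAlgebra₂.toUnr₂ p J)).IsPrincipal := by
    obtain ⟨⟨c, hc⟩⟩ := hP
    have hc' : WeierstrassCurve.XGr₂.charIdeal (W.baseChange K) p κ₁ κ₂ vbar γ₁ γ₂ = Ideal.span {c} := hc
    refine ⟨⟨IwasawaAlgebra₂.toUnr₂ p J c, ?_⟩⟩
    rw [hc', Ideal.map_span, Set.image_singleton]
  exact associated_of_signedLineAnchor hI hpkg.1 hES hG0 hne hdiv

end Summit.BirchSwinnertonDyer.BirchSwinnertonDyer.Cruxes.KobayashiLowerHalfSemistable.Defanchor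

end
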